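/-
COR-CM (cell pub-hodgecm2, stage 2 of the Hodge ladder) — junction B01 `PerLFace_of_PerL`, leaf B01-H `Universe.HeckeWedge10`, step
S2 on the model universe: the Hecke LEVEL `Γ ∩ γ⁻¹Γγ` as a `Level` and BOTH projections of the Hecke correspondence `T_γ` as elements
of `U.Mor`.  AUTHORED by seat b10 gen 16 (prover-pub-hodgecm2-b10-g16-0; staged bytes `HOME/pub-hodgecm2-b10/gen16/B01HeckeTranslation.lean`,
md5 5fcb3dc84a38, farm rc 0 · 0 sorry · trio as the concatenation `concat3_B01HeckeTranslation.lean`), FILED verbatim (this header added)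
by the single owner of B01, prover-pub-hodgecm2-own-b01-0, per RULING HECKE-TWIN (a) — as a NEW sibling file rather than an append
to `CorCM/B01/HeckeTranslation.lean` (p252664 ✔, `BallDatum.translate`) only because the append would exceed the 400-line rule; the
Literature statement of record is b10's `UnitaryBallHeckeTranslation.exists_hom_map_unif_mulVec_eq` (p252189 ✔), consumed here BY NAME.
One def (`Level.heckePair`) + one abbrev + theorems; nothing cited as a record; nothing asserted.
-/
import Summits.HodgeConjecture.CorCM.B01.LevelCovering
import Literature.AlgebraicGeometry.ShimuraVarieties.UnitaryBallHeckeTranslation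
import Literature.NumberTheory.Automorphic.UnitaryGroupArithmeticLevelPairs
import Literature.NumberTheory.Automorphic.AdelicUnitaryGroupDatum
import HarnessLib

/-!
# COR-CM — Hecke translations `X_{Γ'} ⟶ X_Γ`, `[v] ↦ [γ v]`, of the model universe are morphisms (`U.Mor`)

Sequel (cell pub-hodgecm2, junction B01; «HeckeMor», `HOME/b01/IDEA-1b-hecke-wedge-and-overlap.md` §2 step S2) of
`CorCM/B01/LevelCovering.lean` (`Model.exists_mor_pms_map_unif`: the level covering `[v] ↦ [v]` is a morphism),
over the Literature brick `UnitaryBallHeckeTranslation.exists_hom_map_unif_mulVec_eq` (the twisted level covering).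

For ONE hermitian space `V : HermSpace3 L ι₁`, a RATIONAL isometry `γ ∈ U(V₃,h)(L)`
(`γ ∈ unitaryGroup (cmConjRingHom L) V.Hm`) and two levels `Γ', Γ` with `γ Γ' γ⁻¹ ≤ Γ` in `GL₃(L)`:

* `Level.heckePair Γ γ hγ` — **the Hecke level of `γ` as a LEVEL (pair)**: `(Γ ∩ γ⁻¹Γγ, K ∩ γ_f⁻¹Kγ_f)`, the
  tree's `UnitaryGroup.conjPair` (compact open, `Γ(K ∩ γ_f⁻¹Kγ_f) = Γ(K) ∩ γ⁻¹Γ(K)γ`,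
  `UnitaryGroup.arithmeticLevel_conjPair`), torsion-free as a subgroup of `Γ`; `heckePair_le` (`≤ Γ` in the
  `K`-order), `heckePair_Γ_le` (`≤ Γ.Γ` in `GL₃(L)`), `map_conj_heckePair_Γ_le` (`γ (Γ ∩ γ⁻¹Γγ) γ⁻¹ ≤ Γ`);
* `map_ι₁_mem_realPoints_ballDatum` — `γ^{ι₁} ∈ U(H^{τ₁})` for the ball datum of the realising surface
  (clause `datum_H`: its complex Gram matrix is `V.Hm^{ι₁}`);
* `ballDatum_map_Γ_conj_le` — `γ^{ι₁} · Γ'^{τ₁} · (γ^{ι₁})⁻¹ ≤ Γ^{τ₁}` in `GL₃(ℂ)` for the two ball data (clause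
  `datum_Γ`, twice, and `γ Γ' γ⁻¹ ≤ Γ`);
* `exists_heckeTranslate` — in the anisotropic regime there is a morphism of the realising `ℂ`-schemes
  `g : X_{Γ'} ⟶ X_Γ` with `g(ℂ) (unif_{Γ'} v) = unif_Γ (γ^{ι₁} v)` on the negative cone
  (`UnitaryBallHeckeTranslation.exists_hom_map_unif_mulVec_eq_of_mem_realPoints` with `arapura2012_cor_15_4_6_holds`);
* `exists_mor_pms_map_unif_mulVec` — the same on the universe of record `U = picardCMUniverse hHD hI h₁ h₃`:
  `∃ g : U.Mor (U.pms L ι₁ V Γ') (U.pms L ι₁ V Γ), g(ℂ) ∘ unif_{Γ'} = unif_Γ ∘ γ^{ι₁}` on the cone, and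
  `exists_mor_pms_heckePair` — at the Hecke level `Γ' := Γ.heckePair γ hγ` BOTH projections of the Hecke
  correspondence `T_γ` exist as morphisms: `π` over `[v] ↦ [v]` (the level covering) and `π_γ` over `[v] ↦ [γ v]`.

References: G. Shimura, *Introduction to the arithmetic theory of automorphic functions* (1971), §3.1, §7.2–7.3;
N. Bergeron, J. Millson, C. Moeglin, Acta Math. 216 (2016), Introduction §1.1, Part 2 §1.8; D. Arapura,
*Algebraic Geometry over the Complex Numbers* (2012), §15.4 Cor. 15.4.6; V. Platonov, A. Rapinchuk, *Algebraic
groups and number theory* (1994), §4.1 (arithmetic subgroups under `G(F)`-conjugation).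
-/

noncomputable section

open scoped Matrix ComplexOrder
open NumberField CategoryTheory
open Literature.AlgebraicGeometry.Motives
open Literature.AlgebraicGeometry.ShimuraVarieties
open Literature.NumberTheory.Automorphic
open Literature.NumberTheory.Transcendental (Arapura2012_Cor_15_4_6 arapura2012_cor_15_4_6_holds)

namespace Summit.HodgeConjecture.CorCM

/-! ### The Hecke level of a rational isometry, as a level (pair) -/

namespace Level

variable {L : CMField} {ι₁ : L →+* ℂ} {V : HermSpace3 L ι₁}

/-- A rational isometry `γ ∈ U(V₃,h)(L)` as a point of the vendored `UnitaryGroup.rational L⁺ L c̄ 3 Hm` (the two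
subgroups of `GL₃(L)` coincide, `UnitaryGroup.rational_complexConj`). [folklore] -/
abbrev rationalOf (V : HermSpace3 L ι₁) (γ : GL (Fin 3) L) (hγ : γ ∈ unitaryGroup (cmConjRingHom L) V.Hm) :
    UnitaryGroup.rational (↥(maximalRealSubfield L)) L (IsCMField.complexConj L) 3 V.Hm :=
  ⟨γ, by rw [UnitaryGroup.rational_complexConj]; exact hγ⟩

/-- **The Hecke level of `γ` at `Γ`, as a level**: the pair `(Γ ∩ γ⁻¹Γγ, K ∩ γ_f⁻¹Kγ_f)` — the tree's
conjugation pair `UnitaryGroup.conjPair` of the compact open `K` of `Γ`, whose arithmetic level is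
`Γ(K) ∩ γ⁻¹Γ(K)γ` (`UnitaryGroup.arithmeticLevel_conjPair`); torsion-free inside `Γ`.
[cite: Shimura1973, §3.1 Prop. 3.1] -/
def heckePair (Γ : Level V) (γ : GL (Fin 3) L) (hγ : γ ∈ unitaryGroup (cmConjRingHom L) V.Hm) : Level V where
  Γ := Γ.Γ ⊓ Γ.Γ.map (MulAut.conj γ⁻¹).toMonoidHom
  K := UnitaryGroup.conjPair (↥(maximalRealSubfield L)) L (IsCMField.complexConj L) 3 V.Hm Γ.K (rationalOf V γ hγ)
  isCompact_K := UnitaryGroup.isCompact_conjPair Γ.isCompact_K Γ.isOpen_K _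
  isOpen_K := UnitaryGroup.isOpen_conjPair Γ.isOpen_K _
  arithmeticLevel_K := by
    rw [UnitaryGroup.arithmeticLevel_conjPair, Γ.arithmeticLevel_K]
  torsionFree δ hδ hfin := Γ.torsionFree δ (Subgroup.mem_inf.mp hδ).1 hfin

variable (Γ : Level V) {γ : GL (Fin 3) L} (hγ : γ ∈ unitaryGroup (cmConjRingHom L) V.Hm)

/-- The arithmetic group of the Hecke level is `Γ ∩ γ⁻¹Γγ`. [cite: Shimura1973, §3.1 Prop. 3.1] -/
@[simp] theorem heckePair_Γ :
    (Γ.heckePair γ hγ).Γ = Γ.Γ ⊓ Γ.Γ.map (MulAut.conj γ⁻¹).toMonoidHom := rfl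

/-- The compact open of the Hecke level is `K ∩ γ_f⁻¹Kγ_f`. [folklore] -/
theorem heckePair_K :
    (Γ.heckePair γ hγ).K =
      UnitaryGroup.conjPair (↥(maximalRealSubfield L)) L (IsCMField.complexConj L) 3 V.Hm Γ.K (rationalOf V γ hγ) :=
  rfl

/-- `Γ.heckePair γ ≤ Γ` (in the `K`-order of levels). [folklore] -/
theorem heckePair_le : Γ.heckePair γ hγ ≤ Γ := UnitaryGroup.conjPair_le _ _

/-- `Γ ∩ γ⁻¹Γγ ≤ Γ` in `GL₃(L)`. [folklore] -/
theorem heckePair_Γ_le : (Γ.heckePair γ hγ).Γ ≤ Γ.Γ := inf_le_left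

/-- `δ ∈ Γ ∩ γ⁻¹Γγ ⇒ γ δ γ⁻¹ ∈ Γ`. [cite: Shimura1973, §3.1 Prop. 3.1] -/
theorem conj_mem_of_mem_heckePair {δ : GL (Fin 3) L} (hδ : δ ∈ (Γ.heckePair γ hγ).Γ) :
    γ * δ * γ⁻¹ ∈ Γ.Γ := by
  have h := (Subgroup.mem_map_conj_iff _ _ _).1 (Subgroup.mem_inf.mp hδ).2
  simpa using h

/-- **`γ (Γ ∩ γ⁻¹Γγ) γ⁻¹ ≤ Γ`** — the hypothesis of the Hecke translation `[v] ↦ [γ v] : X_{Γ ∩ γ⁻¹Γγ} → X_Γ`.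
[cite: Shimura1973, §7.2–7.3] -/
theorem map_conj_heckePair_Γ_le : (Γ.heckePair γ hγ).Γ.map (MulAut.conj γ).toMonoidHom ≤ Γ.Γ := by
  rintro _ ⟨δ, hδ, rfl⟩
  simpa [MulAut.conj_apply] using Γ.conj_mem_of_mem_heckePair hγ hδ

end Level

namespace Model

open Literature.NumberTheory.Automorphic.PicardCM
open Literature.AlgebraicGeometry.HodgeTheory

section Data

variable (hU : BallQuotientUniformisedDatum) (h₃ : CMAbelianVarietyRealised)
variable {L : CMField} {ι₁ : L →+* ℂ} {V : HermSpace3 L ι₁}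

/-- The complex Gram matrix of the ball datum of a level is `V.Hm^{ι₁}` (clause `datum_H`). [folklore] -/
theorem ballDatum_Hℂ (Γ : Level V) (h : (pmsCode L ι₁ V Γ).IsAnisotropic) :
    (Var.ballDatum hU h₃ (pmsCode L ι₁ V Γ) h).Hℂ = V.Hm.map ι₁ := by
  change ((pmsRealisation hU _).datum h).H.map ((pmsRealisation hU _).datum h).E.subtype = _
  rw [(pmsRealisation hU (pmsCode L ι₁ V Γ)).datum_H h]
  ext i j
  rfl

/-- **`γ^{ι₁} ∈ U(H^{τ₁})`** for the ball datum of the realising surface, `γ ∈ U(V₃,h)(L)`: apply `ι₁` to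
`(γ̄)ᵀ Hm γ = Hm` (`ι₁ ∘ c̄ = conj ∘ ι₁`). [cite: BergeronMillsonMoeglin2016Balls, Part 2 §1.2] -/
theorem map_ι₁_mem_realPoints_ballDatum (Γ : Level V) (h : (pmsCode L ι₁ V Γ).IsAnisotropic)
    {γ : GL (Fin 3) L} (hγ : γ ∈ unitaryGroup (cmConjRingHom L) V.Hm) :
    Matrix.GeneralLinearGroup.map ι₁ γ ∈ (Var.ballDatum hU h₃ (pmsCode L ι₁ V Γ) h).realPoints := by
  rw [ConeChart.mem_unitaryGroup_conj_iff, ballDatum_Hℂ]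
  have hmat := congrArg (fun M : Matrix (Fin 3) (Fin 3) L ↦ M.map ι₁) (mem_unitaryGroup_iff.1 hγ)
  simp only [Matrix.map_mul] at hmat
  have ht : (((γ : Matrix (Fin 3) (Fin 3) L).map (cmConjRingHom L))ᵀ).map ι₁ =
      (((Matrix.GeneralLinearGroup.map ι₁ γ : GL (Fin 3) ℂ) : Matrix (Fin 3) (Fin 3) ℂ))ᴴ := by
    ext i j
    simp only [Matrix.map_apply, Matrix.transpose_apply, Matrix.conjTranspose_apply, Complex.star_def,
      embedding_cmConjRingHom]
    rfl
  rw [ht] at hmat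
  exact hmat

/-- **`γ^{ι₁} Γ'^{τ₁} (γ^{ι₁})⁻¹ ≤ Γ^{τ₁}` in `GL₃(ℂ)`** for the ball data of two levels with `γ Γ' γ⁻¹ ≤ Γ`
(clause `datum_Γ`, twice: each datum's group read in `GL₃(ℂ)` is the level's group read through `ι₁`).
[cite: Shimura1973, §7.2–7.3] -/
theorem ballDatum_map_Γ_conj_le {Γ Γ' : Level V} {γ : GL (Fin 3) L}
    (hconj : Γ'.Γ.map (MulAut.conj γ).toMonoidHom ≤ Γ.Γ)
    (h' : (pmsCode L ι₁ V Γ').IsAnisotropic) (h : (pmsCode L ι₁ V Γ).IsAnisotropic) :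
    ((Var.ballDatum hU h₃ (pmsCode L ι₁ V Γ') h').Γ.map
        (Matrix.GeneralLinearGroup.map (Var.ballDatum hU h₃ (pmsCode L ι₁ V Γ') h').τ₁)).map
        (MulAut.conj (Matrix.GeneralLinearGroup.map ι₁ γ)).toMonoidHom ≤
      (Var.ballDatum hU h₃ (pmsCode L ι₁ V Γ) h).Γ.map
        (Matrix.GeneralLinearGroup.map (Var.ballDatum hU h₃ (pmsCode L ι₁ V Γ) h).τ₁) := by
  change (((pmsRealisation hU _).datum h').Γ.map
      (Matrix.GeneralLinearGroup.map ((pmsRealisation hU _).datum h').E.subtype)).map _ ≤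
    ((pmsRealisation hU _).datum h).Γ.map
      (Matrix.GeneralLinearGroup.map ((pmsRealisation hU _).datum h).E.subtype)
  rw [(pmsRealisation hU (pmsCode L ι₁ V Γ')).datum_Γ h', (pmsRealisation hU (pmsCode L ι₁ V Γ)).datum_Γ h]
  change ((Γ'.Γ.map (Matrix.GeneralLinearGroup.map ι₁.rangeRestrictFieldEquiv.toRingHom)).map
      (Matrix.GeneralLinearGroup.map ι₁.fieldRange.subtype)).map _ ≤
    (Γ.Γ.map (Matrix.GeneralLinearGroup.map ι₁.rangeRestrictFieldEquiv.toRingHom)).map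
      (Matrix.GeneralLinearGroup.map ι₁.fieldRange.subtype)
  -- the composite `GL(subtype) ∘ GL(rangeRestrict)` is `GL(ι₁)`, so it intertwines `conj γ` and `conj γ^{ι₁}`
  have hΦ : ∀ δ : GL (Fin 3) L,
      Matrix.GeneralLinearGroup.map (ι₁.fieldRange.subtype : ι₁.fieldRange →+* ℂ)
          (Matrix.GeneralLinearGroup.map ι₁.rangeRestrictFieldEquiv.toRingHom δ) =
        Matrix.GeneralLinearGroup.map ι₁ δ := fun δ ↦ by
    ext i j
    rfl
  have hcomm :
      (MulAut.conj (Matrix.GeneralLinearGroup.map ι₁ γ)).toMonoidHom.comp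
          ((Matrix.GeneralLinearGroup.map (ι₁.fieldRange.subtype : ι₁.fieldRange →+* ℂ)).comp
            (Matrix.GeneralLinearGroup.map ι₁.rangeRestrictFieldEquiv.toRingHom)) =
        ((Matrix.GeneralLinearGroup.map (ι₁.fieldRange.subtype : ι₁.fieldRange →+* ℂ)).comp
          (Matrix.GeneralLinearGroup.map ι₁.rangeRestrictFieldEquiv.toRingHom)).comp
          (MulAut.conj γ).toMonoidHom := by
    ext δ : 1
    simp only [MonoidHom.comp_apply, MulEquiv.coe_toMonoidHom, MulAut.conj_apply, map_mul, map_inv, hΦ]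
  calc ((Γ'.Γ.map (Matrix.GeneralLinearGroup.map ι₁.rangeRestrictFieldEquiv.toRingHom)).map
          (Matrix.GeneralLinearGroup.map ι₁.fieldRange.subtype)).map
          (MulAut.conj (Matrix.GeneralLinearGroup.map ι₁ γ)).toMonoidHom
      = (Γ'.Γ.map (MulAut.conj γ).toMonoidHom).map
          ((Matrix.GeneralLinearGroup.map (ι₁.fieldRange.subtype : ι₁.fieldRange →+* ℂ)).comp
            (Matrix.GeneralLinearGroup.map ι₁.rangeRestrictFieldEquiv.toRingHom)) := by
        simp only [Subgroup.map_map, hcomm]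
    _ ≤ Γ.Γ.map ((Matrix.GeneralLinearGroup.map (ι₁.fieldRange.subtype : ι₁.fieldRange →+* ℂ)).comp
            (Matrix.GeneralLinearGroup.map ι₁.rangeRestrictFieldEquiv.toRingHom)) := Subgroup.map_mono hconj
    _ = (Γ.Γ.map (Matrix.GeneralLinearGroup.map ι₁.rangeRestrictFieldEquiv.toRingHom)).map
          (Matrix.GeneralLinearGroup.map ι₁.fieldRange.subtype) := (Subgroup.map_map _ _ _).symm

/-- **The Hecke translation is a morphism of the realising schemes** (anisotropic regime): for
`γ ∈ U(V₃,h)(L)` and levels with `γ Γ' γ⁻¹ ≤ Γ` there is `g : X_{Γ'} ⟶ X_Γ` over `ℂ` with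
`g(ℂ) (unif_{Γ'} v) = unif_Γ (γ^{ι₁} v)` on the negative cone — from the kernel theorem
`UnitaryBallHeckeTranslation.exists_hom_map_unif_mulVec_eq_of_mem_realPoints` (same `Hℂ`, `γ^{ι₁} ∈ U(H^{τ₁})`,
conjugated groups), read in the real Hodge models `BettiUniverse.realHodgeModel hHD`, with the record
`Arapura2012_Cor_15_4_6` discharged by the tree theorem `arapura2012_cor_15_4_6_holds`.
[cite: Shimura1973, §7.2–7.3] [cite: Arapura2012, §15.4 Cor. 15.4.6] -/
theorem exists_heckeTranslate (hHD : exists_isReal_hodgeModel) {Γ Γ' : Level V} {γ : GL (Fin 3) L}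
    (hγ : γ ∈ unitaryGroup (cmConjRingHom L) V.Hm) (hconj : Γ'.Γ.map (MulAut.conj γ).toMonoidHom ≤ Γ.Γ)
    (h' : (pmsCode L ι₁ V Γ').IsAnisotropic) (h : (pmsCode L ι₁ V Γ).IsAnisotropic) :
    ∃ g : Var.scheme hU h₃ (.pms (pmsCode L ι₁ V Γ')) ⟶ Var.scheme hU h₃ (.pms (pmsCode L ι₁ V Γ)),
      ∀ v ∈ (Var.ballDatum hU h₃ (pmsCode L ι₁ V Γ') h').cone,
        AlgPoints.map g ((Var.ballDatum hU h₃ (pmsCode L ι₁ V Γ') h').unif v) =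
          (Var.ballDatum hU h₃ (pmsCode L ι₁ V Γ) h).unif (((γ : Matrix (Fin 3) (Fin 3) L).map ι₁) *ᵥ v) :=
  UnitaryBallHeckeTranslation.exists_hom_map_unif_mulVec_eq_of_mem_realPoints arapura2012_cor_15_4_6_holds
    ⟨BettiUniverse.realHodgeModel hHD (Var.isSmoothProjective hU h₃ (.pms (pmsCode L ι₁ V Γ')))⟩
    ⟨BettiUniverse.realHodgeModel hHD (Var.isSmoothProjective hU h₃ (.pms (pmsCode L ι₁ V Γ)))⟩
    (ballDatum_Hℂ_eq hU h₃ Γ Γ' h' h) (map_ι₁_mem_realPoints_ballDatum hU h₃ Γ h hγ)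
    (ballDatum_map_Γ_conj_le hU h₃ hconj h' h)

end Data

/-! ### On the universe of record `picardCMUniverse` -/

section EndState

variable (hHD : exists_isReal_hodgeModel) (hI : hodgePQ_independent_of_hodgeModel)
  (h₁ : BallQuotientUniformised) (h₃ : CMAbelianVarietyRealised)

/-- **The Hecke translation of the universe of record is a morphism**: for `γ ∈ U(V₃,h)(L)` and levels
`Γ', Γ` of an anisotropic hermitian space with `γ Γ' γ⁻¹ ≤ Γ` there is `g : U.Mor (U.pms L ι₁ V Γ') (U.pms L ι₁ V Γ)`,
`U = picardCMUniverse hHD hI h₁ h₃`, lying over `v ↦ γ^{ι₁} v` on the negative cone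
(`U.pms L ι₁ V Γ = .pms (pmsCode L ι₁ V Γ)` and `U.Mor X Y = (Var.scheme _ _ X ⟶ Var.scheme _ _ Y)` by `rfl`).
[cite: Shimura1973, §7.2–7.3] [cite: Arapura2012, §15.4 Cor. 15.4.6] -/
theorem exists_mor_pms_map_unif_mulVec {L : CMField} {ι₁ : L →+* ℂ} {V : HermSpace3 L ι₁} {Γ Γ' : Level V}
    {γ : GL (Fin 3) L} (hγ : γ ∈ unitaryGroup (cmConjRingHom L) V.Hm)
    (hconj : Γ'.Γ.map (MulAut.conj γ).toMonoidHom ≤ Γ.Γ) (h : (pmsCode L ι₁ V Γ).IsAnisotropic) :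
    ∃ g : (picardCMUniverse hHD hI h₁ h₃).Mor ((picardCMUniverse hHD hI h₁ h₃).pms L ι₁ V Γ')
        ((picardCMUniverse hHD hI h₁ h₃).pms L ι₁ V Γ),
      ∀ v ∈ (Var.ballDatum (ballQuotientUniformisedDatum_of h₁) h₃ (pmsCode L ι₁ V Γ')
          ((isAnisotropic_pmsCode_iff_of_level Γ Γ').2 h)).cone,
        AlgPoints.map g ((Var.ballDatum (ballQuotientUniformisedDatum_of h₁) h₃ (pmsCode L ι₁ V Γ')
            ((isAnisotropic_pmsCode_iff_of_level Γ Γ').2 h)).unif v) =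
          (Var.ballDatum (ballQuotientUniformisedDatum_of h₁) h₃ (pmsCode L ι₁ V Γ) h).unif
            (((γ : Matrix (Fin 3) (Fin 3) L).map ι₁) *ᵥ v) :=
  exists_heckeTranslate (ballQuotientUniformisedDatum_of h₁) h₃ hHD hγ hconj
    ((isAnisotropic_pmsCode_iff_of_level Γ Γ').2 h) h

/-- **Both projections of the Hecke correspondence `T_γ` at the Hecke level `Γ' = Γ ∩ γ⁻¹Γγ` are morphisms of
the universe of record**: `π : U.Mor (U.pms L ι₁ V Γ') (U.pms L ι₁ V Γ)` over `[v] ↦ [v]` (the level covering,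
`exists_mor_pms_map_unif`) and `π_γ` over `[v] ↦ [γ^{ι₁} v]` (`exists_mor_pms_map_unif_mulVec` with
`Level.map_conj_heckePair_Γ_le`). [cite: Shimura1973, §7.2–7.3] [cite: BergeronMillsonMoeglin2016Balls, Part 2 §1.8] -/
theorem exists_mor_pms_heckePair {L : CMField} {ι₁ : L →+* ℂ} {V : HermSpace3 L ι₁} (Γ : Level V)
    {γ : GL (Fin 3) L} (hγ : γ ∈ unitaryGroup (cmConjRingHom L) V.Hm) (h : (pmsCode L ι₁ V Γ).IsAnisotropic) :
    ∃ π g : (picardCMUniverse hHD hI h₁ h₃).Mor ((picardCMUniverse hHD hI h₁ h₃).pms L ι₁ V (Γ.heckePair γ hγ))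
        ((picardCMUniverse hHD hI h₁ h₃).pms L ι₁ V Γ),
      ∀ v ∈ (Var.ballDatum (ballQuotientUniformisedDatum_of h₁) h₃ (pmsCode L ι₁ V (Γ.heckePair γ hγ))
          ((isAnisotropic_pmsCode_iff_of_level Γ (Γ.heckePair γ hγ)).2 h)).cone,
        AlgPoints.map π ((Var.ballDatum (ballQuotientUniformisedDatum_of h₁) h₃
            (pmsCode L ι₁ V (Γ.heckePair γ hγ)) ((isAnisotropic_pmsCode_iff_of_level Γ (Γ.heckePair γ hγ)).2 h)).unif v) =
          (Var.ballDatum (ballQuotientUniformisedDatum_of h₁) h₃ (pmsCode L ι₁ V Γ) h).unif v ∧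
        AlgPoints.map g ((Var.ballDatum (ballQuotientUniformisedDatum_of h₁) h₃
            (pmsCode L ι₁ V (Γ.heckePair γ hγ)) ((isAnisotropic_pmsCode_iff_of_level Γ (Γ.heckePair γ hγ)).2 h)).unif v) =
          (Var.ballDatum (ballQuotientUniformisedDatum_of h₁) h₃ (pmsCode L ι₁ V Γ) h).unif
            (((γ : Matrix (Fin 3) (Fin 3) L).map ι₁) *ᵥ v) := by
  obtain ⟨π, hπ⟩ := exists_mor_pms_map_unif hHD hI h₁ h₃ (Γ.heckePair_Γ_le hγ) h
  obtain ⟨g, hg⟩ := exists_mor_pms_map_unif_mulVec hHD hI h₁ h₃ hγ (Γ.map_conj_heckePair_Γ_le hγ) h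
  exact ⟨π, g, fun v hv ↦ ⟨hπ v hv, hg v hv⟩⟩

/-- In particular, for every CM field of degree `> 2` (every face context) both Hecke projections exist at every
level and every rational isometry. [cite: Shimura1973, §7.2–7.3] -/
theorem nonempty_mor_pms_heckePair_of_two_lt {L : CMField} (hL : 2 < Module.finrank ℚ L) {ι₁ : L →+* ℂ}
    {V : HermSpace3 L ι₁} (Γ : Level V) {γ : GL (Fin 3) L} (hγ : γ ∈ unitaryGroup (cmConjRingHom L) V.Hm) :
    Nonempty ((picardCMUniverse hHD hI h₁ h₃).Mor ((picardCMUniverse hHD hI h₁ h₃).pms L ι₁ V (Γ.heckePair γ hγ))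
      ((picardCMUniverse hHD hI h₁ h₃).pms L ι₁ V Γ)) :=
  let ⟨π, _, _⟩ := exists_mor_pms_heckePair hHD hI h₁ h₃ Γ hγ (isAnisotropic_pmsCode_of_two_lt hL Γ); ⟨π⟩

end EndState

end Model

end Summit.HodgeConjecture.CorCM

end
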